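import Summits.MatrixMultiplication.OmegaCensus.LocalUSPOmegaBound
import Literature.Computability.AlgebraicComplexity.ChartUSP

/-!
# ω-census, family (b1-U): the exact ω-bound of a local USP instance through the Coppersmith–Winograd chart

HONEST FRAMING (pub-omega census; verbatim): lottery ticket; floor = certified bounds/negative ranges.
Census bookkeeping for the group-theoretic family, not progress on `ω` (tree: `ω < 2.373`).

CKSU 2005 §6.3 (p. 11): "a local USP is a 𝒞-USP for the `Cyc_ℓ`-chart 𝒞 = ({1,2,3}, A, B, C) with
`A(1) = {0}, B(1) = −Ĥ, C(1) = {0}; A(2) = {1}, B(2) = {0}, C(2) = Ĥ; A(3) = Ĥ, B(3) = {0}, C(3) = {0}`,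
`Ĥ = Cyc_ℓ ∖ {0,1}`" and "Together with the example above, [Thm. 37] gives an analogue of Theorem 33 for local
USPs. Using [the CW USP capacity `3/2^{2/3}`], this example achieves `ω < 2.41`."  Here a LOCAL USP is a family of
rows over `{1,2,3}` (coded `0,1,2`) in which every ordered triple of rows, not all equal, hits in some column the
pattern set `L ∪ {(1,2,3)}`, `L` the local-strong-USP patterns (tree `localStrongUSPPatterns`).

With CKSU Thm. 37 (tree-PROVED `CohnKleinbergSzegedyUmans2005_thm37`) and Thm. 5.5 (tree-PROVED
`CohnKleinbergSzegedyUmans2005_5_5_abelian_holds`): the blocks have `|A_u||B_u||C_u| = (m−2)^k`, so a local USP of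
`s` rows and width `k` gives, for every modulus `m ≥ 4`, `s (m−2)^{kω/3} ≤ m^k`, i.e.

  `ω ≤ 3 (k log m − log s) / (k log (m − 2))`     (`omega_le_of_isLocalUSP`),

and the decimal form `m^{3bk} ≤ s^{3b} (m−2)^{ak} → ω ≤ a/b` (`omega_le_div_of_isLocalUSP`).  At the CW capacity
`s^{1/k} → 3/2^{2/3}` and `m = 10` this is the tree's `omega_le_logb_eight` (`log_8 (4000/27) = 2.4036…`).
The chart is written out literally (no new definitions); `cwChart_hypergraph` checks the seven patterns,
`cwChart_isHChart` the symbol-wise triple product property.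

References: Cohn–Kleinberg–Szegedy–Umans, FOCS 2005 (arXiv:math/0511460) §6.2–6.3, Def. 36, Thm. 37;
Coppersmith–Winograd 1990 §6 (USP capacity, CKSU Thm. 13).
-/

noncomputable section

open Finset
open scoped Pointwise
open Literature.Computability.AlgebraicComplexity

namespace Summit.MatrixMultiplication.OmegaCensus

/-! ### The CW chart, written out: `A = ![{0}, {1}, Ĥ]`, `B = ![−Ĥ, {0}, {0}]`, `C = ![{0}, Ĥ, {0}]`, `Ĥ = univ ∖ {0,1}` -/

/-- The seven local-USP patterns lie in the hypergraph of the CW chart (CKSU Def. 36): for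
`(x,y,z) ∈ L ∪ {(1,2,3)}`, `0 ∉ A(x) − A(y) + B(y) − B(z) + C(z) − C(x)` in `Cyc_m`, `m ≥ 2`.
(Six cases: exactly one of the six sets is `±Ĥ ∌ 0` and the others are `{0}` up to the cancelling `{1} − {1}`;
case `(1,2,3)`: the sum is `{−1}`.) [cite: CohnKleinbergSzegedyUmans2005, Def. 36 and §6.3 (p. 11)] -/
theorem cwChart_hypergraph (m : ℕ) [NeZero m] [Fact (1 < m)] : ∀ x y z : Fin 3,
    (x, y, z) ∈ insert ((0 : Fin 3), (1 : Fin 3), (2 : Fin 3)) localStrongUSPPatterns →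
    (0 : ZMod m) ∉ ((![{0}, {1}, univ \ {0, 1}] : Fin 3 → Finset (ZMod m)) x
        - (![{0}, {1}, univ \ {0, 1}] : Fin 3 → Finset (ZMod m)) y)
      + ((![-(univ \ {0, 1}), {0}, {0}] : Fin 3 → Finset (ZMod m)) y
        - (![-(univ \ {0, 1}), {0}, {0}] : Fin 3 → Finset (ZMod m)) z)
      + ((![{0}, univ \ {0, 1}, {0}] : Fin 3 → Finset (ZMod m)) z
        - (![{0}, univ \ {0, 1}, {0}] : Fin 3 → Finset (ZMod m)) x) := by
  intro x y z hp
  simp only [localStrongUSPPatterns, mem_insert, mem_singleton, Prod.mk.injEq] at hp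
  rcases hp with ⟨rfl, rfl, rfl⟩ | ⟨rfl, rfl, rfl⟩ | ⟨rfl, rfl, rfl⟩ | ⟨rfl, rfl, rfl⟩ | ⟨rfl, rfl, rfl⟩ |
    ⟨rfl, rfl, rfl⟩ | ⟨rfl, rfl, rfl⟩
  all_goals simp [Finset.mem_add, Finset.mem_sdiff]
  all_goals
    intro x _ h1 h
    exact h1 (by linear_combination h)

/-- The CW chart is an `H`-chart (CKSU Def. 36): each symbol's triple `(A(x), B(x), C(x))` has the triple product
property — two of the three sets are singletons, so the relation forces the third pair to agree.
[cite: CohnKleinbergSzegedyUmans2005, Def. 36 and §6.3 (p. 11)] -/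
theorem cwChart_isHChart (m : ℕ) [NeZero m] :
    IsHChart (![{0}, {1}, univ \ {0, 1}] : Fin 3 → Finset (ZMod m))
      (![-(univ \ {0, 1}), {0}, {0}] : Fin 3 → Finset (ZMod m))
      (![{0}, univ \ {0, 1}, {0}] : Fin 3 → Finset (ZMod m)) := by
  intro x
  fin_cases x
  all_goals
    intro a ha a' ha' b hb b' hb' c hc c' hc' h
    simp only [Fin.zero_eta, Fin.mk_one, Fin.reduceFinMk, Matrix.cons_val_zero, Matrix.cons_val_one,
      Matrix.cons_val_two, Matrix.head_cons, Matrix.tail_cons, mem_singleton] at ha ha' hb hb' hc hc'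
  · subst ha ha' hc hc'
    refine ⟨rfl, ?_, rfl⟩
    have : b' - b = 0 := by linear_combination h
    exact (sub_eq_zero.mp this).symm
  · subst ha ha' hb hb'
    refine ⟨rfl, rfl, ?_⟩
    have : c' - c = 0 := by linear_combination h
    exact (sub_eq_zero.mp this).symm
  · subst hb hb' hc hc'
    refine ⟨?_, rfl, rfl⟩
    have : a' - a = 0 := by linear_combination h
    exact (sub_eq_zero.mp this).symm

/-- Column bookkeeping for the CW chart: for every symbol `x`, `|A(x)| · |B(x)| · |C(x)| = m − 2`
(one of the three sets is `±Ĥ`, `|Ĥ| = m − 2`, the other two are singletons), `m ≥ 2`.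
[cite: CohnKleinbergSzegedyUmans2005, §6.3 (p. 11)] -/
theorem cwChart_card_mul (m : ℕ) [NeZero m] [Fact (1 < m)] (x : Fin 3) :
    ((![{0}, {1}, univ \ {0, 1}] : Fin 3 → Finset (ZMod m)) x).card *
      ((![-(univ \ {0, 1}), {0}, {0}] : Fin 3 → Finset (ZMod m)) x).card *
      ((![{0}, univ \ {0, 1}, {0}] : Fin 3 → Finset (ZMod m)) x).card = m - 2 := by
  have hH : (univ \ {0, 1} : Finset (ZMod m)).card = m - 2 := by
    rw [Finset.card_sdiff_of_subset (Finset.subset_univ _), Finset.card_univ, ZMod.card,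
      Finset.card_pair (zero_ne_one' (ZMod m))]
  have hN : (-(univ \ {0, 1} : Finset (ZMod m))).card = m - 2 := by rw [Finset.card_neg, hH]
  fin_cases x <;> simp [hH, hN]

/-- **The census inequality of a local USP (CW chart).** If every ordered triple of rows of `row`, not all
equal, hits `L ∪ {(1,2,3)}` in some column, then for every modulus `m ≥ 2`:
`s · ((m-2)^k)^{ω/3} ≤ m^k` (CKSU Thm. 37 + Thm. 5.5 in `Cyc_m^k`, both tree-proved; block counting).
[cite: CohnKleinbergSzegedyUmans2005, Thm. 37 and Thm. 31] -/
theorem mul_rpow_le_pow_of_isLocalUSP {s k : ℕ} {row : Fin s → Fin k → Fin 3}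
    (hU : ∀ a b c : Fin s, (a ≠ b ∨ b ≠ c) → ∃ i : Fin k,
      (row a i, row b i, row c i) ∈ insert ((0 : Fin 3), (1 : Fin 3), (2 : Fin 3)) localStrongUSPPatterns)
    (m : ℕ) [NeZero m] [Fact (1 < m)] :
    (s : ℝ) * ((((m - 2) ^ k : ℕ) : ℝ)) ^ (omega ℂ / 3) ≤ ((m ^ k : ℕ) : ℝ) := by
  classical
  set A : Fin 3 → Finset (ZMod m) := ![{0}, {1}, univ \ {0, 1}] with hA
  set B : Fin 3 → Finset (ZMod m) := ![-(univ \ {0, 1}), {0}, {0}] with hB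
  set C : Fin 3 → Finset (ZMod m) := ![{0}, univ \ {0, 1}, {0}] with hC
  have hChart : IsHChart A B C := cwChart_isHChart m
  have hL : IsLocalChartUSP A B C row := by
    intro u v w hne
    obtain ⟨i, hi⟩ := hU u v w (by tauto)
    exact ⟨i, cwChart_hypergraph m _ _ _ hi⟩
  have hST := CohnKleinbergSzegedyUmans2005_thm37 hChart hL
  have h55 := CohnKleinbergSzegedyUmans2005_5_5_abelian_holds (Fin k → ZMod m) s (chartBlock A row)
    (chartBlock B row) (chartBlock C row) hST
  have hcard : (Fintype.card (Fin k → ZMod m) : ℝ) = ((m ^ k : ℕ) : ℝ) := by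
    rw [Fintype.card_fun, ZMod.card, Fintype.card_fin]
  rw [hcard] at h55
  have hblk : ∀ i : Fin s, (chartBlock A row i).card * (chartBlock B row i).card * (chartBlock C row i).card
      = (m - 2) ^ k := by
    intro i
    simp only [chartBlock, Fintype.card_piFinset]
    rw [← Finset.prod_mul_distrib, ← Finset.prod_mul_distrib]
    rw [Finset.prod_congr rfl (fun c _ => cwChart_card_mul m (row i c)), Finset.prod_const, Finset.card_univ,
      Fintype.card_fin]
  have hsum : ∑ i : Fin s, ((((chartBlock A row i).card * (chartBlock B row i).card *
      (chartBlock C row i).card : ℕ) : ℝ)) ^ (omega ℂ / 3) = (s : ℝ) * ((((m - 2) ^ k : ℕ) : ℝ)) ^ (omega ℂ / 3) := by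
    simp_rw [hblk]
    rw [Finset.sum_const, Finset.card_univ, Fintype.card_fin, nsmul_eq_mul]
  rw [hsum] at h55
  exact h55

/-- **Exact ω-bound of a local USP instance** (CW chart, closed form): `s ≥ 1` rows, width `k ≥ 1`, modulus
`m ≥ 4`: `ω ≤ 3 (k log m − log s) / (k log (m − 2))`.  [cite: CohnKleinbergSzegedyUmans2005, Thm. 37 and §6.3] -/
theorem omega_le_of_isLocalUSP {s k : ℕ} {row : Fin s → Fin k → Fin 3}
    (hU : ∀ a b c : Fin s, (a ≠ b ∨ b ≠ c) → ∃ i : Fin k,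
      (row a i, row b i, row c i) ∈ insert ((0 : Fin 3), (1 : Fin 3), (2 : Fin 3)) localStrongUSPPatterns)
    (hs : 0 < s) (hk : 0 < k) {m : ℕ} (hm : 4 ≤ m) :
    omega ℂ ≤ 3 * ((k : ℝ) * Real.log m - Real.log s) / ((k : ℝ) * Real.log ((m : ℝ) - 2)) := by
  haveI : NeZero m := ⟨by omega⟩
  haveI : Fact (1 < m) := ⟨by omega⟩
  have key := mul_rpow_le_pow_of_isLocalUSP hU m
  have hX1 : (1 : ℝ) < (m : ℝ) - 2 := by
    have : (4 : ℝ) ≤ (m : ℝ) := by exact_mod_cast hm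
    linarith
  have hX0 : (0 : ℝ) < (m : ℝ) - 2 := by linarith
  have hcast : ((((m - 2) ^ k : ℕ) : ℝ)) = ((m : ℝ) - 2) ^ k := by
    rw [Nat.cast_pow, Nat.cast_sub (by omega : 2 ≤ m), Nat.cast_ofNat]
  rw [hcast] at key
  have hmk : (((m ^ k : ℕ) : ℝ)) = (m : ℝ) ^ k := by rw [Nat.cast_pow]
  rw [hmk] at key
  have hs' : (0 : ℝ) < (s : ℝ) := by exact_mod_cast hs
  have hk' : (0 : ℝ) < (k : ℝ) := by exact_mod_cast hk
  have hm0 : (0 : ℝ) < (m : ℝ) := by linarith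
  have hpow : (((m : ℝ) - 2) ^ k) ^ (omega ℂ / 3) = ((m : ℝ) - 2) ^ ((k : ℝ) * (omega ℂ / 3)) := by
    rw [← Real.rpow_natCast, ← Real.rpow_mul hX0.le]
  rw [hpow] at key
  have hlogX : 0 < Real.log ((m : ℝ) - 2) := Real.log_pos hX1
  have hD : 0 < (k : ℝ) * Real.log ((m : ℝ) - 2) := mul_pos hk' hlogX
  have hlhs : 0 < (s : ℝ) * ((m : ℝ) - 2) ^ ((k : ℝ) * (omega ℂ / 3)) :=
    mul_pos hs' (Real.rpow_pos_of_pos hX0 _)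
  have hlog := Real.log_le_log hlhs key
  rw [Real.log_mul hs'.ne' (Real.rpow_pos_of_pos hX0 _).ne', Real.log_rpow hX0, Real.log_pow] at hlog
  rw [le_div_iff₀ hD]
  nlinarith [hlog]

/-- **Decimal form for local USPs.** `m^{3bk} ≤ s^{3b} · (m−2)^{ak}` with `m ≥ 4`, `s, k, b ≥ 1` gives `ω ≤ a/b`.
[cite: CohnKleinbergSzegedyUmans2005, Thm. 37 and §6.3] -/
theorem omega_le_div_of_isLocalUSP {s k : ℕ} {row : Fin s → Fin k → Fin 3}
    (hU : ∀ a b c : Fin s, (a ≠ b ∨ b ≠ c) → ∃ i : Fin k,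
      (row a i, row b i, row c i) ∈ insert ((0 : Fin 3), (1 : Fin 3), (2 : Fin 3)) localStrongUSPPatterns)
    (hs : 0 < s) (hk : 0 < k) {m : ℕ} (hm : 4 ≤ m) {a b : ℕ} (hb : 0 < b)
    (h : m ^ (3 * b * k) ≤ s ^ (3 * b) * (m - 2) ^ (a * k)) :
    omega ℂ ≤ (a : ℝ) / (b : ℝ) := by
  have hB := omega_le_of_isLocalUSP hU hs hk hm
  have hX1 : (1 : ℝ) < (m : ℝ) - 2 := by
    have : (4 : ℝ) ≤ (m : ℝ) := by exact_mod_cast hm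
    linarith
  have hX0 : (0 : ℝ) < (m : ℝ) - 2 := by linarith
  have hs' : (0 : ℝ) < (s : ℝ) := by exact_mod_cast hs
  have hk' : (0 : ℝ) < (k : ℝ) := by exact_mod_cast hk
  have hb' : (0 : ℝ) < (b : ℝ) := by exact_mod_cast hb
  have hm0 : (0 : ℝ) < (m : ℝ) := by linarith
  have hlogX : 0 < Real.log ((m : ℝ) - 2) := Real.log_pos hX1
  have hD : 0 < (k : ℝ) * Real.log ((m : ℝ) - 2) := mul_pos hk' hlogX
  have hR : ((m ^ (3 * b * k) : ℕ) : ℝ) ≤ ((s ^ (3 * b) * (m - 2) ^ (a * k) : ℕ) : ℝ) := by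
    exact_mod_cast h
  rw [Nat.cast_pow, Nat.cast_mul, Nat.cast_pow, Nat.cast_pow, Nat.cast_sub (by omega : 2 ≤ m),
    Nat.cast_ofNat] at hR
  have hpos1 : (0 : ℝ) < (m : ℝ) ^ (3 * b * k) := pow_pos hm0 _
  have hlog := Real.log_le_log hpos1 hR
  rw [Real.log_pow, Real.log_mul (pow_pos hs' _).ne' (pow_pos hX0 _).ne', Real.log_pow, Real.log_pow] at hlog
  refine hB.trans ?_
  rw [div_le_div_iff₀ hD hb']
  push_cast at hlog ⊢
  nlinarith [hlog, hlogX, hk', hb', Real.log_pos (show (1 : ℝ) < 3 by norm_num)]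

end Summit.MatrixMultiplication.OmegaCensus

end
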